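import Literature.AlgebraicGeometry.Resolution.NormalizationInExtension
import Literature.AlgebraicGeometry.Resolution.AlterationsDimension
import Literature.AlgebraicGeometry.Resolution.ResolutionOfCurves
import Literature.AlgebraicGeometry.Resolution.ArithmeticalThreefolds

/-!
# Crux `Picover`, line `degree-p-tower`: the residue in dimension `≤ 1` (unconditional) and
# `≤ 2` (modulo Cossart–Jannsen–Saito)

Route `ResolutionOfSingularities/pAlteration`, crux `Picover` (stmt-ResolutionOfSingularities-0554),
residue programme (lead c1). Companion of the landed `Theorems/PAlterationPicoverDegPDimLeThree.lean`
(`dim W ≤ 3` modulo `CossartPiltant2019`); this file completes the dimension table of the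
residue `stub_picoverDegP` (`W` regular integral separated of finite type over `k`, `L/K(W)`
purely inseparable of degree `p` ⟹ `W^L = normalizationIn W L` has a resolution):

* `dim W ≤ 1`: UNCONDITIONAL — `W^L → W` is a finite alteration, so `dim W^L = dim W ≤ 1`, and a
  reduced curve of finite type over a field is resolved by its normalization (tree:
  `hasResolution_of_dim_le_one`, `ResolutionOfCurves.lean`);
* `dim W ≤ 2`: modulo the named fact `CossartJannsenSaito2020` (resolution of excellent surfaces,
  `∀ k, ResolutionOverUpToDim k 2`);

in both cases for ANY finite `L/K(W)` and without regularity of `W` (as in dimension `≤ 3`). So a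
counterexample to the residue (equivalently to the crux) lives in `dim W ≥ 4` modulo
Cossart–Piltant, `≥ 3` modulo Cossart–Jannsen–Saito only, and `≥ 2` unconditionally in this tree.
-/

noncomputable section

set_option linter.dupNamespace false -- mandated namespace of this single-conjunct summit

open CategoryTheory AlgebraicGeometry TopologicalSpace
open Literature.AlgebraicGeometry.Resolution

namespace Summit.ResolutionOfSingularities.ResolutionOfSingularities.Theorems.Picover.DegPLowDim

/-- **The normalization of a curve in a finite extension is resolvable, unconditionally.** For an
integral scheme `W` of finite type over a field `k` with `dim W ≤ 1` and a finite extension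
`L/K(W)`, `W^L` has a resolution: `dim W^L = dim W ≤ 1` (`W^L → W` is a finite alteration) and
reduced curves are resolved by normalization. [folklore] -/
theorem hasResolution_normalizationIn_of_dim_le_one {k : Type} [Field k] (W : Scheme.{0})
    [IsIntegral W] (f : W ⟶ Spec (.of k)) [LocallyOfFiniteType f] [QuasiCompact f] (L : Type)
    [Field L] [Algebra W.functionField L] [FiniteDimensional W.functionField L]
    (hdim : topologicalKrullDim W ≤ 1) : Scheme.HasResolution (normalizationIn W L) := by
  haveI : IsFinite (normalizationInι W L) := isFinite_normalizationInι W L f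
  have hdim' : topologicalKrullDim (normalizationIn W L) ≤ 1 := by
    rw [(isAlteration_normalizationInι W L f).topologicalKrullDim_eq f]
    exact hdim
  haveI : LocallyOfFiniteType (normalizationInι W L ≫ f) := inferInstance
  haveI : QuasiCompact (normalizationInι W L ≫ f) := inferInstance
  exact hasResolution_of_dim_le_one (normalizationIn W L) (normalizationInι W L ≫ f) hdim'

/-- **`stub_picoverDegP` restricted to `dim W ≤ 1`, UNCONDITIONAL** (the residue of the line
`degree-p-tower` in its registered shape with the extra hypothesis `dim W ≤ 1`; regularity,
separatedness, pure inseparability and the degree are not used). [folklore] -/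
theorem picoverDegP_of_dim_le_one : ∀ (p : ℕ), p.Prime → ∀ (k : Type) [Field k] [CharP k p] (W : Scheme.{0}) [IsIntegral W] (f : W ⟶ Spec (.of k)) (L : Type) [Field L] [Algebra W.functionField L], IsSeparated f → LocallyOfFiniteType f → QuasiCompact f → Scheme.IsRegular W → IsPurelyInseparable W.functionField L → Module.finrank W.functionField L = p → topologicalKrullDim W ≤ 1 → Scheme.HasResolution (normalizationIn W L) := by
  intro p hp k _ _ W _ f L _ _ _ _ _ _ _ hdeg hdim
  haveI : FiniteDimensional W.functionField L :=
    Module.finite_of_finrank_pos (by rw [hdeg]; exact hp.pos)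
  exact hasResolution_normalizationIn_of_dim_le_one W f L hdim

/-- **The normalization of a surface in a finite extension is resolvable, modulo
Cossart–Jannsen–Saito.** For an integral scheme `W` separated of finite type over a field `k`
with `dim W ≤ 2` and a finite extension `L/K(W)`, `W^L` has a resolution, conditionally on the
named fact `CossartJannsenSaito2020` (LNM 2270, Thm. 1.2, in the weak form over fields).
[cite: CossartJannsenSaito2020, Thm. 1.2] -/
theorem hasResolution_normalizationIn_of_dim_le_two (hCJS : CossartJannsenSaito2020.{0})
    {k : Type} [Field k] (W : Scheme.{0}) [IsIntegral W] (f : W ⟶ Spec (.of k)) [IsSeparated f]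
    [LocallyOfFiniteType f] [QuasiCompact f] (L : Type) [Field L] [Algebra W.functionField L]
    [FiniteDimensional W.functionField L] (hdim : topologicalKrullDim W ≤ 2) :
    Scheme.HasResolution (normalizationIn W L) := by
  haveI : IsFinite (normalizationInι W L) := isFinite_normalizationInι W L f
  have hdim' : topologicalKrullDim (normalizationIn W L) ≤ 2 := by
    rw [(isAlteration_normalizationInι W L f).topologicalKrullDim_eq f]
    exact hdim
  haveI : IsSeparated (normalizationInι W L ≫ f) := inferInstance
  haveI : LocallyOfFiniteType (normalizationInι W L ≫ f) := inferInstance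
  haveI : QuasiCompact (normalizationInι W L ≫ f) := inferInstance
  exact hCJS k (normalizationIn W L) (normalizationInι W L ≫ f) inferInstance inferInstance
    inferInstance inferInstance (by exact_mod_cast hdim')

/-- **`stub_picoverDegP` restricted to `dim W ≤ 2`, modulo Cossart–Jannsen–Saito** (registered
shape plus `dim W ≤ 2` and the named fact `CossartJannsenSaito2020`).
[cite: CossartJannsenSaito2020, Thm. 1.2] -/
theorem picoverDegP_of_dim_le_two : CossartJannsenSaito2020.{0} → ∀ (p : ℕ), p.Prime → ∀ (k : Type) [Field k] [CharP k p] (W : Scheme.{0}) [IsIntegral W] (f : W ⟶ Spec (.of k)) (L : Type) [Field L] [Algebra W.functionField L], IsSeparated f → LocallyOfFiniteType f → QuasiCompact f → Scheme.IsRegular W → IsPurelyInseparable W.functionField L → Module.finrank W.functionField L = p → topologicalKrullDim W ≤ 2 → Scheme.HasResolution (normalizationIn W L) := by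
  intro hCJS p hp k _ _ W _ f L _ _ _ _ _ _ _ hdeg hdim
  haveI : FiniteDimensional W.functionField L :=
    Module.finite_of_finrank_pos (by rw [hdeg]; exact hp.pos)
  exact hasResolution_normalizationIn_of_dim_le_two hCJS W f L hdim

end Summit.ResolutionOfSingularities.ResolutionOfSingularities.Theorems.Picover.DegPLowDim

end
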